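import Summits.Ventures.PercRepro.MSSplitCount

/-!
# Step 4 of Theorem 10.1, part 1: the basic facts and the cases (η), (θ)

proofs/P4-gen9.md §10, Step 4. Under `CoverHyp u F s t` and NO COVER (`∀ a b ∈ F, a ∪ b ≠ u`):

* basic facts: `union_eq_of_subsets` (a pair with `A₆ ⊆ a`, `A₄ ⊆ b` covers), `inter_nonempty`
  (every cross pair meets — `a ∩ b = ∅` would make `a = a \ b` a difference), the (α) facts
  (every coordinate of `A₅ ∪ A₆` lies in some member of `s` and misses some; likewise `A₃ ∪ A₄`
  with `t`), `false_of_three_mem_rest` (three distinct elements of the rest contradict (★)),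
  `pair_eq_of_card_rest_le_one` (with `|rest| ≤ 1` all mixed good pairs coincide);
* case (η) `false_of_mem_traces_both`: `A₅ ∈ T` and `A₃ ∈ S` — `X* = A₁ ∪ A₃ ∪ A₅ ∈ s` and
  `Y* = A₂ ∪ A₅ ∪ A₃ ∈ t` are incomparable only if `A₁ ≠ ∅ ≠ A₂`; no cover puts a coordinate
  `x ∈ A₄ ∪ A₆` outside `X* ∪ Y*`, and `a \ Y*` (or `b \ X*`) with `x` in it is a third element of
  the rest besides `{a₁}`, `{a₂}`;
* case (θ) `false_of_notMem_traces_both`: `A₅ ∉ T` and `A₃ ∉ S` — the rest is empty; a coordinate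
  `x ∈ A₆` (or `A₄`, by symmetry) in some `a ∈ s` forces `A₃ ⊆ b` for all `b ∈ t` (no mixed set),
  so `A₃ = ∅` by (α); intersecting gives `y ∈ A₅ ∩ a ∩ b₀`, some `a′` misses `y`, and no mixed
  set forces `b ∩ A₄ = ∅` for all `b`, so the trace of `b₀` is `∅ = A₃ ∈ S`.
-/

namespace PercRepro.MSTight

open Finset
open scoped FinsetFamily

variable {α : Type*} [DecidableEq α]

section Basic

variable {u : Finset α} {F s t : Finset (Finset α)}

omit [DecidableEq α] in
/-- Not in every member: some member misses `x`. -/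
theorem not_inAll {s : Finset (Finset α)} {x : α} : ¬ InAll s x ↔ ∃ a ∈ s, x ∉ a := by
  simp [InAll]

omit [DecidableEq α] in
/-- Not in no member: some member contains `x`. -/
theorem not_inNone {s : Finset (Finset α)} {x : α} : ¬ InNone s x ↔ ∃ a ∈ s, x ∈ a := by
  simp [InNone]

/-- Members of `s` are members of `F`. -/
theorem mem_F_of_mem_s (h : CoverHyp u F s t) {a : Finset α} (ha : a ∈ s) : a ∈ F := by
  rw [← h.split.union]; exact Finset.mem_union_left t ha

/-- Members of `t` are members of `F`. -/
theorem mem_F_of_mem_t (h : CoverHyp u F s t) {b : Finset α} (hb : b ∈ t) : b ∈ F := by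
  rw [← h.split.union]; exact Finset.mem_union_right s hb

/-- A difference of two members is a good set. -/
theorem sdiff_mem_diffs {a b : Finset α} (ha : a ∈ F) (hb : b ∈ F) : a \ b ∈ F \\ F :=
  Finset.mem_diffs.2 ⟨a, ha, b, hb, rfl⟩

omit [DecidableEq α] in
/-- `A₁` lies in every member of `s`. -/
theorem mem_of_mem_classA1 {r : α} (hr : r ∈ classA1 u s t) {a : Finset α} (ha : a ∈ s) :
    r ∈ a := (mem_classA1.1 hr).2.1 a ha
omit [DecidableEq α] in
/-- `A₁` misses every member of `t`. -/
theorem notMem_of_mem_classA1 {r : α} (hr : r ∈ classA1 u s t) {b : Finset α} (hb : b ∈ t) :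
    r ∉ b := (mem_classA1.1 hr).2.2 b hb
omit [DecidableEq α] in
/-- `A₂` misses every member of `s`. -/
theorem notMem_of_mem_classA2 {r : α} (hr : r ∈ classA2 u s t) {a : Finset α} (ha : a ∈ s) :
    r ∉ a := (mem_classA2.1 hr).2.1 a ha
omit [DecidableEq α] in
/-- `A₂` lies in every member of `t`. -/
theorem mem_of_mem_classA2 {r : α} (hr : r ∈ classA2 u s t) {b : Finset α} (hb : b ∈ t) :
    r ∈ b := (mem_classA2.1 hr).2.2 b hb
omit [DecidableEq α] in
/-- `A₃` lies in every member of `s`. -/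
theorem mem_of_mem_classA3 {r : α} (hr : r ∈ classA3 u s t) {a : Finset α} (ha : a ∈ s) :
    r ∈ a := (mem_classA3.1 hr).2.1 a ha
omit [DecidableEq α] in
/-- `A₄` misses every member of `s`. -/
theorem notMem_of_mem_classA4 {r : α} (hr : r ∈ classA4 u s t) {a : Finset α} (ha : a ∈ s) :
    r ∉ a := (mem_classA4.1 hr).2.1 a ha
omit [DecidableEq α] in
/-- `A₅` lies in every member of `t`. -/
theorem mem_of_mem_classA5 {r : α} (hr : r ∈ classA5 u s t) {b : Finset α} (hb : b ∈ t) :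
    r ∈ b := (mem_classA5.1 hr).2.1 b hb
omit [DecidableEq α] in
/-- `A₆` misses every member of `t`. -/
theorem notMem_of_mem_classA6 {r : α} (hr : r ∈ classA6 u s t) {b : Finset α} (hb : b ∈ t) :
    r ∉ b := (mem_classA6.1 hr).2.1 b hb

/-- (α): a coordinate of `A₅` misses some member of `s`. -/
theorem exists_notMem_of_mem_classA5 (h : CoverHyp u F s t) {x : α} (hx : x ∈ classA5 u s t) :
    ∃ a ∈ s, x ∉ a := by
  obtain ⟨hxu, hIt, -⟩ := mem_classA5.1 hx
  obtain ⟨-, h2, -⟩ := classes_cover h x hxu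
  exact not_inAll.1 fun hIs => h2 ⟨hIs, hIt⟩

omit [DecidableEq α] in
/-- (α): a coordinate of `A₅` lies in some member of `s`. -/
theorem exists_mem_of_mem_classA5 {x : α} (hx : x ∈ classA5 u s t) : ∃ a ∈ s, x ∈ a :=
  not_inNone.1 (mem_classA5.1 hx).2.2

omit [DecidableEq α] in
/-- (α): a coordinate of `A₆` misses some member of `s`. -/
theorem exists_notMem_of_mem_classA6 {x : α} (hx : x ∈ classA6 u s t) : ∃ a ∈ s, x ∉ a :=
  not_inAll.1 (mem_classA6.1 hx).2.2

/-- (α): a coordinate of `A₆` lies in some member of `s`. -/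
theorem exists_mem_of_mem_classA6 (h : CoverHyp u F s t) {x : α} (hx : x ∈ classA6 u s t) :
    ∃ a ∈ s, x ∈ a := by
  obtain ⟨hxu, hOt, -⟩ := mem_classA6.1 hx
  obtain ⟨-, -, h3⟩ := classes_cover h x hxu
  exact not_inNone.1 fun hOs => h3 ⟨hOs, hOt⟩

/-- (α): a coordinate of `A₃` misses some member of `t`. -/
theorem exists_notMem_of_mem_classA3 (h : CoverHyp u F s t) {z : α} (hz : z ∈ classA3 u s t) :
    ∃ b ∈ t, z ∉ b := by
  obtain ⟨hzu, hIs, -⟩ := mem_classA3.1 hz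
  obtain ⟨-, h2, -⟩ := classes_cover h z hzu
  exact not_inAll.1 fun hIt => h2 ⟨hIs, hIt⟩

omit [DecidableEq α] in
/-- (α): a coordinate of `A₃` lies in some member of `t`. -/
theorem exists_mem_of_mem_classA3 {z : α} (hz : z ∈ classA3 u s t) : ∃ b ∈ t, z ∈ b :=
  not_inNone.1 (mem_classA3.1 hz).2.2

omit [DecidableEq α] in
/-- (α): a coordinate of `A₄` misses some member of `t`. -/
theorem exists_notMem_of_mem_classA4 {z : α} (hz : z ∈ classA4 u s t) : ∃ b ∈ t, z ∉ b :=
  not_inAll.1 (mem_classA4.1 hz).2.2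

/-- (α): a coordinate of `A₄` lies in some member of `t`. -/
theorem exists_mem_of_mem_classA4 (h : CoverHyp u F s t) {z : α} (hz : z ∈ classA4 u s t) :
    ∃ b ∈ t, z ∈ b := by
  obtain ⟨hzu, hOs, -⟩ := mem_classA4.1 hz
  obtain ⟨-, -, h3⟩ := classes_cover h z hzu
  exact not_inNone.1 fun hOt => h3 ⟨hOs, hOt⟩

/-- `A₅ ∩ A₆ = ∅`. -/
theorem not_mem_classA5_and_classA6 (h : CoverHyp u F s t) {x : α} (h5 : x ∈ classA5 u s t)
    (h6 : x ∈ classA6 u s t) : False := by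
  obtain ⟨b, hb⟩ := h.split.ne_t
  exact notMem_of_mem_classA6 h6 hb (mem_of_mem_classA5 h5 hb)

/-- `A₃ ∩ A₄ = ∅`. -/
theorem not_mem_classA3_and_classA4 (h : CoverHyp u F s t) {x : α} (h3 : x ∈ classA3 u s t)
    (h4 : x ∈ classA4 u s t) : False := by
  obtain ⟨a, ha⟩ := h.split.ne_s
  exact notMem_of_mem_classA4 h4 ha (mem_of_mem_classA3 h3 ha)

omit [DecidableEq α] in
/-- Swapping the sides turns `A₁` into `A₂`. -/
theorem classA1_symm : classA1 u t s = classA2 u s t := (classA2_symm (s := t) (t := s)).symm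
omit [DecidableEq α] in
/-- Swapping the sides turns `A₃` into `A₅`. -/
theorem classA3_symm : classA3 u t s = classA5 u s t := (classA5_symm (s := t) (t := s)).symm
omit [DecidableEq α] in
/-- Swapping the sides turns `A₄` into `A₆`. -/
theorem classA4_symm : classA4 u t s = classA6 u s t := (classA6_symm (s := t) (t := s)).symm

/-- The rest is symmetric in the two sides. -/
theorem rest_symm : rest u F t s = rest u F s t := by
  ext W
  rw [mem_rest, mem_rest, classA5_symm, classA6_symm, classA3_symm, classA4_symm]
  tauto

/-- A pair `a ∈ s`, `b ∈ t` with `A₆ ⊆ a` and `A₄ ⊆ b` covers the support. -/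
theorem union_eq_of_subsets (h : CoverHyp u F s t) {a b : Finset α} (ha : a ∈ s) (hb : b ∈ t)
    (h6 : classA6 u s t ⊆ a) (h4 : classA4 u s t ⊆ b) : a ∪ b = u := by
  apply Finset.Subset.antisymm
  · exact Finset.union_subset (h.support a (mem_F_of_mem_s h ha))
      (h.support b (mem_F_of_mem_t h hb))
  · intro r hr
    rw [Finset.mem_union]
    rcases mem_classes h hr with h1 | h2 | h3 | h4' | h5 | h6'
    · exact Or.inl (mem_of_mem_classA1 h1 ha)
    · exact Or.inr (mem_of_mem_classA2 h2 hb)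
    · exact Or.inl (mem_of_mem_classA3 h3 ha)
    · exact Or.inr (h4 h4')
    · exact Or.inr (mem_of_mem_classA5 h5 hb)
    · exact Or.inl (h6 h6')

/-- Every cross pair meets (else `a = a \ b` would be a difference). -/
theorem inter_nonempty (h : CoverHyp u F s t) {a b : Finset α} (ha : a ∈ s) (hb : b ∈ t) :
    (a ∩ b).Nonempty := by
  rw [Finset.nonempty_iff_ne_empty]
  intro hab
  have hd : a \ b = a :=
    Finset.sdiff_eq_self_of_disjoint (Finset.disjoint_iff_inter_eq_empty.2 hab)
  apply h.notMem a (mem_F_of_mem_s h ha)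
  rw [← hd]
  exact sdiff_mem_diffs (mem_F_of_mem_s h ha) (mem_F_of_mem_t h hb)

/-- Three distinct elements of the rest contradict (★). -/
theorem false_of_three_mem_rest (h : CoverHyp u F s t) {W₁ W₂ W₃ : Finset α}
    (h1 : W₁ ∈ rest u F s t) (h2 : W₂ ∈ rest u F s t) (h3 : W₃ ∈ rest u F s t) (h12 : W₁ ≠ W₂)
    (h13 : W₁ ≠ W₃) (h23 : W₂ ≠ W₃) : False := by
  have hst := star h
  have hc : 2 < (rest u F s t).card :=
    Finset.two_lt_card.2 ⟨W₁, h1, W₂, h2, W₃, h3, h12, h13, h23⟩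
  split_ifs at hst <;> omega

/-- With `|rest| ≤ 1`, two mixed good pairs `{x, y}`, `{x′, y′}` (`x, x′` in the `s`-half,
`y, y′` in the `t`-half) coincide. -/
theorem pair_eq_of_card_rest_le_one (h : CoverHyp u F s t) (hc : (rest u F s t).card ≤ 1)
    {W W' : Finset α} (hW : W ∈ F \\ F) (hW' : W' ∈ F \\ F) {x y x' y' : α} (hx : x ∈ W)
    (hy : y ∈ W) (hx' : x' ∈ W') (hy' : y' ∈ W') (hxR : x ∈ classA5 u s t ∪ classA6 u s t)
    (hyR : y ∈ classA3 u s t ∪ classA4 u s t) (hx'R : x' ∈ classA5 u s t ∪ classA6 u s t)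
    (hy'R : y' ∈ classA3 u s t ∪ classA4 u s t) : x = x' ∧ y = y' := by
  have h1 : ({x, y} : Finset α) ∈ rest u F s t :=
    mem_rest_of_mixed h (h.down _ hW _ (Finset.insert_subset_iff.2
      ⟨hx, Finset.singleton_subset_iff.2 hy⟩)) (Finset.mem_insert_self x {y}) hxR
      (Finset.mem_insert_of_mem (Finset.mem_singleton_self y)) hyR
  have h2 : ({x', y'} : Finset α) ∈ rest u F s t :=
    mem_rest_of_mixed h (h.down _ hW' _ (Finset.insert_subset_iff.2
      ⟨hx', Finset.singleton_subset_iff.2 hy'⟩)) (Finset.mem_insert_self x' {y'}) hx'R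
      (Finset.mem_insert_of_mem (Finset.mem_singleton_self y')) hy'R
  have heq : ({x, y} : Finset α) = {x', y'} := Finset.card_le_one.1 hc _ h1 _ h2
  have hx'' : x ∈ ({x', y'} : Finset α) := by rw [← heq]; exact Finset.mem_insert_self x {y}
  have hy'' : y ∈ ({x', y'} : Finset α) := by
    rw [← heq]; exact Finset.mem_insert_of_mem (Finset.mem_singleton_self y)
  simp only [Finset.mem_insert, Finset.mem_singleton] at hx'' hy''
  constructor
  · rcases hx'' with e | e
    · exact e
    · rw [e] at hxR
      exact absurd hy'R (Finset.disjoint_left.1 (disjoint_halves h) hxR)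
  · rcases hy'' with e | e
    · rw [e] at hyR
      exact absurd hyR (Finset.disjoint_left.1 (disjoint_halves h) hx'R)
    · exact e

end Basic

section CasesEtaTheta

variable {u : Finset α} {F s t : Finset (Finset α)}

/-- **Case (η)**: `A₅ ∈ T` and `A₃ ∈ S` are impossible without a cover. -/
theorem false_of_mem_traces_both (h : CoverHyp u F s t) (hnc : ∀ a ∈ F, ∀ b ∈ F, a ∪ b ≠ u)
    (hT : classA5 u s t ∈ s.image (fun a => a ∩ (classA5 u s t ∪ classA6 u s t)))
    (hS : classA3 u s t ∈ t.image (fun b => b ∩ (classA3 u s t ∪ classA4 u s t))) : False := by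
  obtain ⟨X, hX, hXtr⟩ := Finset.mem_image.1 hT
  obtain ⟨Y, hY, hYtr⟩ := Finset.mem_image.1 hS
  have hXeq : X = classA1 u s t ∪ classA3 u s t ∪ classA5 u s t := by
    rw [mem_s_eq h hX, hXtr]
  have hYeq : Y = classA2 u s t ∪ classA5 u s t ∪ classA3 u s t := by
    rw [mem_t_eq h hY, hYtr]
  -- cross-incomparability gives `a₁ ∈ A₁` and `a₂ ∈ A₂`
  have hcross := h.split.cross X hX Y hY
  obtain ⟨a₁, ha₁X, ha₁Y⟩ := Finset.not_subset.1 hcross.1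
  obtain ⟨a₂, ha₂Y, ha₂X⟩ := Finset.not_subset.1 hcross.2
  have ha₁ : a₁ ∈ classA1 u s t := by
    rw [hXeq] at ha₁X; rw [hYeq] at ha₁Y
    simp only [Finset.mem_union, not_or] at ha₁X ha₁Y
    rcases ha₁X with (h1 | h3) | h5
    · exact h1
    · exact absurd h3 ha₁Y.2
    · exact absurd h5 ha₁Y.1.2
  have ha₂ : a₂ ∈ classA2 u s t := by
    rw [hYeq] at ha₂Y; rw [hXeq] at ha₂X
    simp only [Finset.mem_union, not_or] at ha₂Y ha₂X
    rcases ha₂Y with (h2 | h5) | h3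
    · exact h2
    · exact absurd h5 ha₂X.2
    · exact absurd h3 ha₂X.1.2
  have hne12 : a₁ ≠ a₂ := fun e =>
    Finset.disjoint_left.1 (disjoint_classA1_classA2 h) ha₁ (e ▸ ha₂)
  have hs1 : ({a₁} : Finset α) ∈ rest u F s t :=
    mem_rest_of_mem_classA1 h (h.sing a₁ (mem_classA1.1 ha₁).1) ha₁ (Finset.mem_singleton_self a₁)
  have hs2 : ({a₂} : Finset α) ∈ rest u F s t :=
    mem_rest_of_mem_classA2 h (h.sing a₂ (mem_classA2.1 ha₂).1) ha₂ (Finset.mem_singleton_self a₂)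
  -- no cover: a coordinate outside `X ∪ Y`, necessarily in `A₄` or `A₆`
  have hsub : ¬ u ⊆ X ∪ Y := fun hu =>
    hnc X (mem_F_of_mem_s h hX) Y (mem_F_of_mem_t h hY) (Finset.Subset.antisymm
      (Finset.union_subset (h.support X (mem_F_of_mem_s h hX))
        (h.support Y (mem_F_of_mem_t h hY))) hu)
  obtain ⟨x, hxu, hxXY⟩ := Finset.not_subset.1 hsub
  rw [Finset.mem_union, not_or] at hxXY
  rcases mem_classes h hxu with h1 | h2 | h3 | h4 | h5 | h6
  · exact absurd (mem_of_mem_classA1 h1 hX) hxXY.1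
  · exact absurd (mem_of_mem_classA2 h2 hY) hxXY.2
  · exact absurd (mem_of_mem_classA3 h3 hX) hxXY.1
  · -- `x ∈ A₄`: `b \ X` with `x ∈ b` is a third element of the rest
    obtain ⟨b, hb, hxb⟩ := exists_mem_of_mem_classA4 h h4
    have hW : b \ X ∈ F \\ F := sdiff_mem_diffs (mem_F_of_mem_t h hb) (mem_F_of_mem_s h hX)
    have ha₂W : a₂ ∈ b \ X :=
      Finset.mem_sdiff.2 ⟨mem_of_mem_classA2 ha₂ hb, notMem_of_mem_classA2 ha₂ hX⟩
    have hxW : x ∈ b \ X := Finset.mem_sdiff.2 ⟨hxb, notMem_of_mem_classA4 h4 hX⟩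
    have hWr : b \ X ∈ rest u F s t := mem_rest_of_mem_classA2 h hW ha₂ ha₂W
    refine false_of_three_mem_rest h hs1 hs2 hWr ?_ ?_ ?_
    · intro e; exact hne12 (Finset.singleton_inj.1 e)
    · intro e; rw [← e] at ha₂W; exact hne12 (Finset.mem_singleton.1 ha₂W).symm
    · intro e
      rw [← e] at hxW
      have e' := Finset.mem_singleton.1 hxW
      rw [e'] at h4
      exact (notMem_halves_of_mem_classA2 h ha₂).2 (Finset.mem_union_right _ h4)
  · exact absurd (mem_of_mem_classA5 h5 hY) hxXY.2
  · -- `x ∈ A₆`: `a \ Y` with `x ∈ a` is a third element of the rest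
    obtain ⟨a, ha, hxa⟩ := exists_mem_of_mem_classA6 h h6
    have hW : a \ Y ∈ F \\ F := sdiff_mem_diffs (mem_F_of_mem_s h ha) (mem_F_of_mem_t h hY)
    have ha₁W : a₁ ∈ a \ Y :=
      Finset.mem_sdiff.2 ⟨mem_of_mem_classA1 ha₁ ha, notMem_of_mem_classA1 ha₁ hY⟩
    have hxW : x ∈ a \ Y := Finset.mem_sdiff.2 ⟨hxa, notMem_of_mem_classA6 h6 hY⟩
    have hWr : a \ Y ∈ rest u F s t := mem_rest_of_mem_classA1 h hW ha₁ ha₁W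
    refine false_of_three_mem_rest h hs1 hs2 hWr ?_ ?_ ?_
    · intro e; exact hne12 (Finset.singleton_inj.1 e)
    · intro e
      rw [← e] at hxW
      have e' := Finset.mem_singleton.1 hxW
      rw [e'] at h6
      exact (notMem_halves_of_mem_classA1 h ha₁).1 (Finset.mem_union_right _ h6)
    · intro e; rw [← e] at ha₁W; exact hne12 (Finset.mem_singleton.1 ha₁W)

/-- **Case (θ), core**: with an empty rest and `A₃ ∉ S`, no coordinate lies in `A₆`. -/
theorem false_of_mem_classA6_of_rest_eq_empty (h : CoverHyp u F s t)
    (hrest : rest u F s t = ∅)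
    (hS : classA3 u s t ∉ t.image (fun b => b ∩ (classA3 u s t ∪ classA4 u s t))) {x : α}
    (hx : x ∈ classA6 u s t) : False := by
  have hno : ∀ W, W ∉ rest u F s t := fun W hW => by
    rw [hrest] at hW; exact Finset.notMem_empty W hW
  obtain ⟨a, ha, hxa⟩ := exists_mem_of_mem_classA6 h hx
  -- `A₃ ⊆ b` for every `b ∈ t` (no mixed set `a \ b`)
  have hA3 : ∀ b ∈ t, classA3 u s t ⊆ b := by
    intro b hb z hz
    by_contra hzb
    apply hno (a \ b)
    exact mem_rest_of_mixed h (sdiff_mem_diffs (mem_F_of_mem_s h ha) (mem_F_of_mem_t h hb))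
      (Finset.mem_sdiff.2 ⟨hxa, notMem_of_mem_classA6 hx hb⟩) (Finset.mem_union_right _ hx)
      (Finset.mem_sdiff.2 ⟨mem_of_mem_classA3 hz ha, hzb⟩) (Finset.mem_union_left _ hz)
  have hA3e : ∀ z, z ∉ classA3 u s t := by
    intro z hz
    obtain ⟨b, hb, hzb⟩ := exists_notMem_of_mem_classA3 h hz
    exact hzb (hA3 b hb hz)
  -- intersecting: `y ∈ a ∩ b₀` lies in `A₅`
  obtain ⟨b₀, hb₀⟩ := h.split.ne_t
  obtain ⟨y, hy⟩ := inter_nonempty h ha hb₀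
  obtain ⟨hya, hyb⟩ := Finset.mem_inter.1 hy
  have hyu : y ∈ u := h.support a (mem_F_of_mem_s h ha) hya
  have hy5 : y ∈ classA5 u s t := by
    rcases mem_classes h hyu with h1 | h2 | h3 | h4 | h5 | h6
    · exact absurd hyb (notMem_of_mem_classA1 h1 hb₀)
    · exact absurd hya (notMem_of_mem_classA2 h2 ha)
    · exact absurd h3 (hA3e y)
    · exact absurd hya (notMem_of_mem_classA4 h4 ha)
    · exact h5
    · exact absurd hyb (notMem_of_mem_classA6 h6 hb₀)
  obtain ⟨a', ha', hya'⟩ := exists_notMem_of_mem_classA5 h hy5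
  -- no member of `t` meets `A₄` (no mixed set `b \ a′`)
  have hA4 : ∀ b ∈ t, ∀ w ∈ classA4 u s t, w ∉ b := by
    intro b hb w hw hwb
    apply hno (b \ a')
    exact mem_rest_of_mixed h (sdiff_mem_diffs (mem_F_of_mem_t h hb) (mem_F_of_mem_s h ha'))
      (Finset.mem_sdiff.2 ⟨mem_of_mem_classA5 hy5 hb, hya'⟩) (Finset.mem_union_left _ hy5)
      (Finset.mem_sdiff.2 ⟨hwb, notMem_of_mem_classA4 hw ha'⟩) (Finset.mem_union_right _ hw)
  -- so the trace of `b₀` is `∅ = A₃`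
  apply hS
  refine Finset.mem_image.2 ⟨b₀, hb₀, ?_⟩
  ext z
  simp only [Finset.mem_inter, Finset.mem_union]
  constructor
  · rintro ⟨hzb, hz3 | hz4⟩
    · exact absurd hz3 (hA3e z)
    · exact absurd hzb (hA4 b₀ hb₀ z hz4)
  · intro hz; exact absurd hz (hA3e z)

/-- **Case (θ)**: `A₅ ∉ T` and `A₃ ∉ S` are impossible without a cover. -/
theorem false_of_notMem_traces_both (h : CoverHyp u F s t) (hnc : ∀ a ∈ F, ∀ b ∈ F, a ∪ b ≠ u)
    (hT : classA5 u s t ∉ s.image (fun a => a ∩ (classA5 u s t ∪ classA6 u s t)))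
    (hS : classA3 u s t ∉ t.image (fun b => b ∩ (classA3 u s t ∪ classA4 u s t))) : False := by
  have hrest : rest u F s t = ∅ := by
    have hst := star h
    rw [if_neg hT, if_neg hS] at hst
    exact Finset.card_eq_zero.1 (by omega)
  obtain ⟨a₀, ha₀⟩ := h.split.ne_s
  obtain ⟨b₀, hb₀⟩ := h.split.ne_t
  have h46 : (∃ x, x ∈ classA6 u s t) ∨ ∃ x, x ∈ classA4 u s t := by
    by_contra hno
    push Not at hno
    exact hnc a₀ (mem_F_of_mem_s h ha₀) b₀ (mem_F_of_mem_t h hb₀) (union_eq_of_subsets h ha₀ hb₀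
      (fun x hx => absurd hx (hno.1 x)) (fun x hx => absurd hx (hno.2 x)))
  rcases h46 with ⟨x, hx⟩ | ⟨x, hx⟩
  · exact false_of_mem_classA6_of_rest_eq_empty h hrest hS hx
  · refine false_of_mem_classA6_of_rest_eq_empty (x := x) h.symm ?_ ?_ ?_
    · rw [rest_symm]; exact hrest
    · rw [classA3_symm, classA4_symm]; exact hT
    · rw [classA6_symm]; exact hx

end CasesEtaTheta

end PercRepro.MSTight
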